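import Mathlib
import Literature.NumberTheory.Transcendental.AssociatorsHexagonProofs
import HarnessLib

/-!
# Associators V: primitive series and the linearized pentagon [Furusho2010, §1; BarnatanDancso2011, §4]

Fourth proofs file towards [Furusho2010, Thm 1] (`furusho_pentagon_hexagon`). It starts the
formalisation of the Lie-algebra version [Furusho2010, Thm 3] = [BarnatanDancso2011, Main Lemma
3.2] ("the linearized pentagon equation implies the linearized hexagon equation"), in
Bar-Natan–Dancso's form in `𝒜₄ = U𝔞₄`:

1. `NCSeries.IsPrimitive ψ` — `ψ` is **primitive** (Lie-like, `Δψ = ψ ⊗ 1 + 1 ⊗ ψ`), stated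
   coefficientwise as for `NCSeries.IsGroupLike`: `c_∅(ψ) = 0` and `Σ_{w ∈ u ш v} c_w(ψ) = 0` for
   all non-empty words `u, v` (Ree's theorem; the coproduct is the transpose of the shuffle
   product, Racinet 2002, §2).
2. Degenerate evaluations and central shifts of primitive series without linear terms:
   `ψ(A, B) = 0` for `AB = BA` (`IsPrimitive.evalTrunc_eq_zero_of_commute`) and
   `ψ(A + C, B) = ψ(A, B) = ψ(A, B + C)` for `C` commuting with `A, B`
   (`IsPrimitive.evalTrunc_bsub_add_left/right`) — the facts "`ψ ∈ 𝔉₂' = [𝔉₂, 𝔉₂]`" used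
   throughout [Furusho2010, §1] and [BarnatanDancso2011, Lemma 4.2].
3. `NCSeries.dP N ψ`, `NCSeries.dH N ψ` — the **linearized pentagon and hexagon**
   `dP(ψ) = -ψ(t₁₂,t₂₃+t₂₄) - ψ(t₁₃+t₂₃,t₃₄) + ψ(t₂₃,t₃₄) + ψ(t₁₂+t₁₃,t₂₄+t₃₄) + ψ(t₁₂,t₂₃)`,
   `dH(ψ) = ψ(t₁₃,t₁₂) - ψ(t₁₃,t₂₃) + ψ(t₁₂,t₂₃)` [BarnatanDancso2011, §4, first display], in the
   weight truncations of `U𝔞₄` (strands `1..4 ↦ 0..3`).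
4. **[BarnatanDancso2011, Lemma 4.1]** `NCSeries.IsPrimitive.antisymm_of_dP`: a primitive `ψ`
   without linear terms, supported in weight `≤ N`, with `dP_N(ψ) = 0` is anti-symmetric,
   `ψ(X,Y) + ψ(Y,X) = 0` — via the projection `q` of `AssociatorsProofs.lean`.

No named facts are introduced.

## References

* H. Furusho, *Pentagon and hexagon equations*, Ann. of Math. 171 (2010), 545–556, §1 (Thm 3).
  [Furusho2010]
* D. Bar-Natan, Z. Dancso, *Pentagon and hexagon equations following Furusho*, Proc. AMS 140
  (2012), 1243–1250, §4, Lemma 4.1. [BarnatanDancso2011]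
* G. Racinet, *Doubles mélanges des polylogarithmes multiples aux racines de l'unité*, Publ.
  Math. IHÉS 95 (2002), §2. [Racinet2002]
-/

noncomputable section

open scoped BigOperators

namespace Literature.NumberTheory.Transcendental

universe u v

namespace NCSeries

variable {α : Type u} {R : Type v}

/-! ## 1. Primitive series -/

section Primitive

variable [Semiring R]

/-- A series `ψ ∈ R⟨⟨α⟩⟩` is **primitive** (Lie-like): `Δψ = ψ ⊗ 1 + 1 ⊗ ψ` for the coproduct with
primitive letters. As `Δ` is the transpose of the shuffle product (Racinet 2002, §2; cf.
`NCSeries.count_deshuffle`), this is recorded coefficientwise: `c_∅(ψ) = 0` and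
`Σ_{w ∈ u ш v} c_w(ψ) = 0` for all non-empty words `u, v` (Ree's theorem: over a `ℚ`-algebra
these are exactly the Lie series). [cite: Racinet2002, §2] -/
def IsPrimitive (ψ : NCSeries α R) : Prop :=
  ψ [] = 0 ∧ ∀ u v : List α, u ≠ [] → v ≠ [] → ((MZV.shuffleWord u v).map ψ).sum = 0

/-- A primitive series has no constant term. [folklore] -/
theorem IsPrimitive.apply_nil {ψ : NCSeries α R} (h : IsPrimitive ψ) : ψ [] = 0 := h.1

/-- The shuffle relations of a primitive series. [folklore] -/
theorem IsPrimitive.sum_shuffleWord_eq_zero {ψ : NCSeries α R} (h : IsPrimitive ψ) {u v : List α}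
    (hu : u ≠ []) (hv : v ≠ []) : ((MZV.shuffleWord u v).map ψ).sum = 0 := h.2 u v hu hv

/-- `0` is primitive. [folklore] -/
theorem isPrimitive_zero : IsPrimitive (0 : NCSeries α R) :=
  ⟨rfl, fun u v _ _ => by
    rw [show (MZV.shuffleWord u v).map (0 : NCSeries α R) =
      (MZV.shuffleWord u v).map (fun _ => (0 : R)) from rfl]
    simp⟩

/-- Primitive series form a submodule: sums. [folklore] -/
theorem IsPrimitive.add {ψ χ : NCSeries α R} (hψ : IsPrimitive ψ) (hχ : IsPrimitive χ) :
    IsPrimitive (ψ + χ) := by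
  refine ⟨by simp [hψ.1, hχ.1], fun u v hu hv => ?_⟩
  have h : ((MZV.shuffleWord u v).map (ψ + χ)).sum =
      ((MZV.shuffleWord u v).map ψ).sum + ((MZV.shuffleWord u v).map χ).sum := by
    rw [← List.sum_map_add]; rfl
  rw [h, hψ.2 u v hu hv, hχ.2 u v hu hv, add_zero]

/-- Primitive series form a submodule: scalar multiples. [folklore] -/
theorem IsPrimitive.smul {S : Type*} [Semiring S] [Module S R] [IsScalarTower S R R]
    {ψ : NCSeries α R} (hψ : IsPrimitive ψ) (s : S) : IsPrimitive (s • ψ) := by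
  refine ⟨by simp [hψ.1], fun u v hu hv => ?_⟩
  have h : ((MZV.shuffleWord u v).map (s • ψ)).sum = s • ((MZV.shuffleWord u v).map ψ).sum := by
    rw [List.smul_sum, List.map_map]; rfl
  rw [h, hψ.2 u v hu hv, smul_zero]

end Primitive

section PrimitiveRing

variable [Ring R]

/-- Primitive series form a submodule: negatives. [folklore] -/
theorem IsPrimitive.neg {ψ : NCSeries α R} (hψ : IsPrimitive ψ) : IsPrimitive (-ψ) := by
  have h := hψ.smul (-1 : R)
  rwa [neg_one_smul] at h

/-- Shuffles commute with the exchange of letters. [folklore] -/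
theorem shuffleWord_map_not : ∀ u v : List Bool, MZV.shuffleWord (u.map not) (v.map not) =
    (MZV.shuffleWord u v).map (List.map not) := by
  intro u v
  induction u generalizing v with
  | nil => simp
  | cons a u ihu =>
    induction v with
    | nil => simp
    | cons b v ihv =>
      rw [List.map_cons, List.map_cons, MZV.shuffleWord_cons_cons, MZV.shuffleWord_cons_cons,
        List.map_append, ← List.map_cons (f := not) (a := b) (l := v), ihu (b :: v),
        ← List.map_cons (f := not) (a := a) (l := u), ihv,
        List.map_map, List.map_map, List.map_map, List.map_map]
      rfl

/-- Primitivity is preserved by the exchange of letters `X ↔ Y`. [folklore] -/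
theorem isPrimitive_swapXY {ψ : NCSeries Bool R} (hψ : IsPrimitive ψ) :
    IsPrimitive (NCSeries.swapXY ψ) := by
  refine ⟨by simpa using hψ.1, fun u v hu hv => ?_⟩
  have h := hψ.2 (u.map not) (v.map not) (by simpa using hu) (by simpa using hv)
  rw [shuffleWord_map_not, List.map_map] at h
  exact h

end PrimitiveRing

/-! ## 2. Degenerate evaluations and central shifts of primitive series -/

section PrimitiveEval

/-- The words with `i` zeros and `j` ones, as the support of `0ⁱ ш 1ʲ`: summing any function over
them is summing it over that shuffle. [folklore] -/
theorem sum_filter_count_eq_sum_shuffleWord {M : Type*} [AddCommMonoid M] (f : List Bool → M)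
    (N i j : ℕ) (hij : i + j ≤ N) :
    ∑ w ∈ (wordsLE Bool N).filter (fun w => (w.count false, w.count true) = (i, j)), f w =
      ((MZV.shuffleWord (List.replicate i false) (List.replicate j true)).map f).sum := by
  have hnodup : (MZV.shuffleWord (List.replicate i false) (List.replicate j true)).Nodup :=
    List.nodup_iff_count_le_one.mpr fun w => by
      rw [count_shuffleWord_replicate]; split_ifs <;> omega
  have hset : (MZV.shuffleWord (List.replicate i false) (List.replicate j true)).toFinset =
      (wordsLE Bool N).filter (fun w => (w.count false, w.count true) = (i, j)) := by
    ext w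
    rw [List.mem_toFinset, Finset.mem_filter, mem_wordsLE, ← List.count_pos_iff,
      count_shuffleWord_replicate, Prod.mk.injEq]
    constructor
    · intro h
      by_cases hw : w.count false = i ∧ w.count true = j
      · refine ⟨?_, hw⟩
        have : w.count false + w.count true = w.length := List.count_not_add_count w true
        omega
      · rw [if_neg hw] at h
        exact absurd h (lt_irrefl 0)
    · rintro ⟨-, hw⟩
      rw [if_pos hw]
      exact Nat.one_pos
  rw [← List.sum_toFinset _ hnodup, hset]

variable {R : Type v} [CommRing R] [Algebra ℚ R]

/-- For a primitive series over a `ℚ`-algebra, `c_{aⁿ}(ψ) = 0` for `n ≥ 2`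
(`0 = Σ_{a ш aⁿ⁻¹} = n c_{aⁿ}`). [folklore] -/
theorem IsPrimitive.apply_replicate_eq_zero [DecidableEq α] {ψ : NCSeries α R} (hp : IsPrimitive ψ)
    (a : α) : ∀ n : ℕ, 2 ≤ n → ψ (List.replicate n a) = 0 := by
  intro n hn
  obtain ⟨m, rfl⟩ := Nat.exists_eq_add_of_le' hn
  have h := hp.2 [a] (List.replicate (m + 1) a) (by simp) (by simp)
  rw [shuffleWord_singleton_replicate, List.map_replicate, List.sum_replicate] at h
  have h' : ((m + 2 : ℕ) : ℚ) • ψ (List.replicate (m + 2) a) = 0 := by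
    rw [Nat.cast_smul_eq_nsmul]; exact h
  have hne : ((m + 2 : ℕ) : ℚ) ≠ 0 := Nat.cast_ne_zero.mpr (by omega)
  calc ψ (List.replicate (m + 2) a)
      = ((m + 2 : ℕ) : ℚ)⁻¹ • (((m + 2 : ℕ) : ℚ) • ψ (List.replicate (m + 2) a)) := by
        rw [smul_smul, inv_mul_cancel₀ hne, one_smul]
    _ = 0 := by rw [h', smul_zero]

/-- Powers of a letter: `c_{aⁿ}(ψ) = 0` for all `n` when `ψ` is primitive with `c_a(ψ) = 0`.
[folklore] -/
theorem IsPrimitive.apply_replicate_eq_zero' [DecidableEq α] {ψ : NCSeries α R} (hp : IsPrimitive ψ)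
    {a : α} (ha : ψ [a] = 0) (n : ℕ) : ψ (List.replicate n a) = 0 := by
  rcases n with _ | _ | n
  · exact hp.1
  · simpa using ha
  · exact hp.apply_replicate_eq_zero a (n + 2) (by omega)

/-- **Fiber sums of a primitive series vanish**: `Σ_{#0(w) = i, #1(w) = j} c_w(ψ) = 0` whenever
`ψ` is primitive with `c_X(ψ) = c_Y(ψ) = 0`. [folklore] -/
theorem IsPrimitive.sum_filter_count_eq_zero {ψ : NCSeries Bool R} (hp : IsPrimitive ψ)
    (h0 : ψ [false] = 0) (h1 : ψ [true] = 0) (N i j : ℕ) :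
    ∑ w ∈ (wordsLE Bool N).filter (fun w => (w.count false, w.count true) = (i, j)), ψ w = 0 := by
  by_cases hij : i + j ≤ N
  · rw [sum_filter_count_eq_sum_shuffleWord ψ N i j hij]
    rcases Nat.eq_zero_or_pos i with hi | hi
    · subst hi
      rw [List.replicate_zero, MZV.shuffleWord_nil_left, List.map_singleton, List.sum_singleton]
      exact hp.apply_replicate_eq_zero' h1 j
    · rcases Nat.eq_zero_or_pos j with hj | hj
      · subst hj
        rw [List.replicate_zero, MZV.shuffleWord_nil_right, List.map_singleton, List.sum_singleton]
        exact hp.apply_replicate_eq_zero' h0 i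
      · exact hp.2 _ _ (by simp; omega) (by simp; omega)
  · refine Finset.sum_eq_zero fun w hw => ?_
    exfalso
    rw [Finset.mem_filter, mem_wordsLE, Prod.mk.injEq] at hw
    have : w.count false + w.count true = w.length := List.count_not_add_count w true
    omega

/-- **Degenerate evaluations of primitive series vanish**: `ψ(A, B) = 0` in every weight
truncation when `AB = BA` and `ψ` is primitive with `c_X(ψ) = c_Y(ψ) = 0` (a Lie series without
linear terms evaluated on commuting arguments). [cite: Furusho2010, §1] -/
theorem IsPrimitive.evalTrunc_eq_zero_of_commute {A : Type*} [Ring A] [Algebra R A]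
    {ψ : NCSeries Bool R} (hp : IsPrimitive ψ) (h0 : ψ [false] = 0) (h1 : ψ [true] = 0) (N : ℕ)
    {a b : A} (hab : Commute a b) : evalTrunc N (bsub a b) ψ = 0 := by
  rw [evalTrunc_eq_sum_wordsLE]
  simp_rw [prod_map_bsub_of_commute hab]
  rw [← Finset.sum_fiberwise_of_maps_to (s := wordsLE Bool N)
    (t := Finset.range (N + 1) ×ˢ Finset.range (N + 1))
    (g := fun w : List Bool => (w.count false, w.count true)) (fun w hw => ?_)]
  · refine Finset.sum_eq_zero ?_
    rintro ⟨i, j⟩ -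
    have hc : ∀ w ∈ (wordsLE Bool N).filter (fun w => (w.count false, w.count true) = (i, j)),
        ψ w • (a ^ w.count false * b ^ w.count true) = ψ w • (a ^ i * b ^ j) := by
      intro w hw
      rw [Finset.mem_filter, Prod.mk.injEq] at hw
      rw [hw.2.1, hw.2.2]
    rw [Finset.sum_congr rfl hc, ← Finset.sum_smul, hp.sum_filter_count_eq_zero h0 h1 N i j,
      zero_smul]
  · simp only [Finset.mem_product, Finset.mem_range]
    rw [mem_wordsLE] at hw
    have : w.count false + w.count true = w.length := List.count_not_add_count w true
    constructor <;> omega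

/-- **Central-shift invariance for primitive series, first slot**: `ψ(A + C, B) = ψ(A, B)` when
`C` commutes with `A, B` and `ψ` is primitive with `c_X(ψ) = 0` ("`ψ ∈ 𝔉₂'`",
[Furusho2010, §1]; [BarnatanDancso2011, proof of Lemma 4.2]). [cite: Furusho2010, §1] -/
theorem IsPrimitive.evalTrunc_bsub_add_left {A : Type*} [Ring A] [Algebra R A]
    {ψ : NCSeries Bool R} (hp : IsPrimitive ψ) (h0 : ψ [false] = 0) (N : ℕ) {a b c : A}
    (hca : Commute c a) (hcb : Commute c b) :
    evalTrunc N (bsub (a + c) b) ψ = evalTrunc N (bsub a b) ψ := by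
  rw [evalTrunc_eq_sum_wordsLE, evalTrunc_eq_sum_wordsLE]
  have hexp : ∀ w : List Bool, (w.map (bsub (a + c) b)).prod =
      ((deshuffle w).map fun p => (p.1.map (bsub a b)).prod * (p.2.map (bsub c 0)).prod).sum := by
    intro w
    have h := prod_map_bsub_add hca hcb (Commute.zero_left a) (Commute.zero_left b) w
    rwa [add_zero] at h
  simp_rw [hexp]
  rw [sum_smul_deshuffle_eq ψ N]
  refine Finset.sum_congr rfl fun u hu => ?_
  rw [mem_wordsLE] at hu
  by_cases hun : u = []
  · subst hun
    rw [hp.1, zero_smul]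
    refine Finset.sum_eq_zero fun u' _ => ?_
    split_ifs with h
    · rw [MZV.shuffleWord_nil_left, List.map_singleton, List.sum_singleton]
      by_cases ht : true ∈ u'
      · rw [prod_map_bsub_zero_right_eq_zero c ht, mul_zero, smul_zero]
      · have hu' : u' = List.replicate u'.length false :=
          List.eq_replicate_iff.mpr ⟨rfl, fun x hx => by
            cases x
            · rfl
            · exact absurd hx ht⟩
        rw [hu', hp.apply_replicate_eq_zero' h0, zero_smul]
    · rfl
  · rw [Finset.sum_eq_single_of_mem [] (by simp) ?_]
    · simp [hu]
    · intro u' _ hne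
      split_ifs with h
      · rw [hp.2 u u' hun hne, zero_smul]
      · rfl

/-- **Central-shift invariance for primitive series, second slot**: `ψ(A, B + C) = ψ(A, B)` when
`C` commutes with `A, B` and `ψ` is primitive with `c_Y(ψ) = 0`. [cite: Furusho2010, §1] -/
theorem IsPrimitive.evalTrunc_bsub_add_right {A : Type*} [Ring A] [Algebra R A]
    {ψ : NCSeries Bool R} (hp : IsPrimitive ψ) (h1 : ψ [true] = 0) (N : ℕ) {a b c : A}
    (hca : Commute c a) (hcb : Commute c b) :
    evalTrunc N (bsub a (b + c)) ψ = evalTrunc N (bsub a b) ψ := by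
  rw [evalTrunc_eq_sum_wordsLE, evalTrunc_eq_sum_wordsLE]
  have hexp : ∀ w : List Bool, (w.map (bsub a (b + c))).prod =
      ((deshuffle w).map fun p => (p.1.map (bsub a b)).prod * (p.2.map (bsub 0 c)).prod).sum := by
    intro w
    have h := prod_map_bsub_add (Commute.zero_left a) (Commute.zero_left b) hca hcb w
    rwa [add_zero] at h
  simp_rw [hexp]
  rw [sum_smul_deshuffle_eq ψ N]
  refine Finset.sum_congr rfl fun u hu => ?_
  rw [mem_wordsLE] at hu
  by_cases hun : u = []
  · subst hun
    rw [hp.1, zero_smul]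
    refine Finset.sum_eq_zero fun u' _ => ?_
    split_ifs with h
    · rw [MZV.shuffleWord_nil_left, List.map_singleton, List.sum_singleton]
      by_cases hf : false ∈ u'
      · rw [prod_map_bsub_zero_left_eq_zero c hf, mul_zero, smul_zero]
      · have hu' : u' = List.replicate u'.length true :=
          List.eq_replicate_iff.mpr ⟨rfl, fun x hx => by
            cases x
            · exact absurd hx hf
            · rfl⟩
        rw [hu', hp.apply_replicate_eq_zero' h1, zero_smul]
    · rfl
  · rw [Finset.sum_eq_single_of_mem [] (by simp) ?_]
    · simp [hu]
    · intro u' _ hne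
      split_ifs with h
      · rw [hp.2 u u' hun hne, zero_smul]
      · rfl

end PrimitiveEval

/-! ## 3. The linearized pentagon and hexagon -/

section Linearized

variable (k : Type u) [CommRing k]

/-- **The linearized pentagon** `dP(ψ) ∈ 𝒜₄ = U𝔞₄` [BarnatanDancso2011, §4]:
`dP(ψ) = -ψ(t₁₂, t₂₃+t₂₄) - ψ(t₁₃+t₂₃, t₃₄) + ψ(t₂₃, t₃₄) + ψ(t₁₂+t₁₃, t₂₄+t₃₄) + ψ(t₁₂, t₂₃)`,
in weight truncation `N` (strands `1,2,3,4 ↦ 0,1,2,3`): the differential of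
`Φ ↦ P(Φ)` at group-like solutions, `P(Φ) - P(Φ') = dP((Φ - Φ')_m)` modulo degree `m + 1`.
[cite: BarnatanDancso2011, §4] -/
def dP (N : ℕ) (ψ : NCSeries Bool k) : DrinfeldKohnoTrunc k (Fin 4) N :=
  -subst₂ N ψ (t₄ k N 0 1) (t₄ k N 1 2 + t₄ k N 1 3) -
        subst₂ N ψ (t₄ k N 0 2 + t₄ k N 1 2) (t₄ k N 2 3) +
      subst₂ N ψ (t₄ k N 1 2) (t₄ k N 2 3) +
    subst₂ N ψ (t₄ k N 0 1 + t₄ k N 0 2) (t₄ k N 1 3 + t₄ k N 2 3) +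
  subst₂ N ψ (t₄ k N 0 1) (t₄ k N 1 2)

/-- **The linearized hexagon** `dH(ψ) = ψ(t₁₃, t₁₂) - ψ(t₁₃, t₂₃) + ψ(t₁₂, t₂₃) ∈ 𝒜₃ ⊂ 𝒜₄`
[BarnatanDancso2011, §4], in weight truncation `N` (strands `1,2,3 ↦ 0,1,2`).
[cite: BarnatanDancso2011, §4] -/
def dH (N : ℕ) (ψ : NCSeries Bool k) : DrinfeldKohnoTrunc k (Fin 4) N :=
  subst₂ N ψ (t₄ k N 0 2) (t₄ k N 0 1) - subst₂ N ψ (t₄ k N 0 2) (t₄ k N 1 2) +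
    subst₂ N ψ (t₄ k N 0 1) (t₄ k N 1 2)

variable {k}

/-- **The image of the linearized pentagon under `q`** (labels `(P, Q)`): in
`k⟨⟨X,Y⟩⟩/(deg > N)`, `q(dP(ψ)) = -ψ(P,-P) - ψ(-P,P) + ψ(Q,P) + ψ(-Q,-Q) + ψ(P,Q)`.
[cite: BarnatanDancso2011, Lemma 4.1] -/
theorem projQ_dP (N : ℕ) (ψ : NCSeries Bool k) (P Q : NCSeries Bool k) (hP : P [] = 0)
    (hQ : Q [] = 0) :
    projQ k N P Q hP hQ (dP k N ψ) =
      -Ideal.Quotient.mk (truncIdeal Bool k N) (evalTrunc N (bsub P (-P)) ψ) -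
            Ideal.Quotient.mk (truncIdeal Bool k N) (evalTrunc N (bsub (-P) P) ψ) +
          Ideal.Quotient.mk (truncIdeal Bool k N) (evalTrunc N (bsub Q P) ψ) +
        Ideal.Quotient.mk (truncIdeal Bool k N) (evalTrunc N (bsub (-Q) (-Q)) ψ) +
      Ideal.Quotient.mk (truncIdeal Bool k N) (evalTrunc N (bsub P Q) ψ) := by
  simp only [dP, map_add, map_sub, map_neg, subst₂, algHom_evalTrunc, comp_bsub, projQ_t]
  have e01 : (qLab P Q ((0 : Fin 4) : ℕ) ((1 : Fin 4) : ℕ)) = P := rfl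
  have e12 : (qLab P Q ((1 : Fin 4) : ℕ) ((2 : Fin 4) : ℕ)) = Q := rfl
  have e13 : (qLab P Q ((1 : Fin 4) : ℕ) ((3 : Fin 4) : ℕ)) = -P - Q := rfl
  have e02 : (qLab P Q ((0 : Fin 4) : ℕ) ((2 : Fin 4) : ℕ)) = -P - Q := rfl
  have e23 : (qLab P Q ((2 : Fin 4) : ℕ) ((3 : Fin 4) : ℕ)) = P := rfl
  rw [e01, e12, e13, e02, e23]
  simp only [← map_add]
  have a1 : Q + (-P - Q) = -P := by abel
  have a2 : -P - Q + Q = -P := by abel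
  have a3 : P + (-P - Q) = -Q := by abel
  have a4 : -P - Q + P = -Q := by abel
  rw [a1, a2, a3, a4]
  simp only [← mk_evalTrunc]

variable [Algebra ℚ k]

/-- **[BarnatanDancso2011, Lemma 4.1]: the linearized pentagon forces anti-symmetry.** If
`ψ ∈ k⟨⟨X,Y⟩⟩` is primitive without linear terms, supported in weight `≤ N`, and
`dP_N(ψ) = 0`, then `ψ(X,Y) + ψ(Y,X) = 0` (apply `q`: `q(dP(ψ)) = ψ(X,Y) + ψ(Y,X)`, the
degenerate evaluations of a primitive series vanishing). [cite: BarnatanDancso2011, Lemma 4.1] -/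
theorem IsPrimitive.antisymm_of_dP {ψ : NCSeries Bool k} (hp : IsPrimitive ψ) (h0 : ψ [false] = 0)
    (h1 : ψ [true] = 0) {N : ℕ} (hsupp : ∀ w : List Bool, N < w.length → ψ w = 0)
    (hP : dP k N ψ = 0) : ψ + NCSeries.swapXY ψ = 0 := by
  have hX₀ : (X₀ : NCSeries Bool k) [] = 0 := by simp
  have hX₁ : (X₁ : NCSeries Bool k) [] = 0 := by simp
  have h := projQ_dP N ψ X₀ X₁ hX₀ hX₁
  rw [hP, map_zero] at h
  have hdeg : ∀ {A B : NCSeries Bool k}, Commute A B →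
      Ideal.Quotient.mk (truncIdeal Bool k N) (evalTrunc N (bsub A B) ψ) = 0 := by
    intro A B hAB
    rw [mk_evalTrunc]
    exact hp.evalTrunc_eq_zero_of_commute h0 h1 N
      (hAB.map (Ideal.Quotient.mk (truncIdeal Bool k N)))
  rw [hdeg (Commute.neg_right (Commute.refl _)), hdeg (Commute.neg_left (Commute.refl _)),
    hdeg (Commute.refl _), mk_evalTrunc_X₀_X₁, mk_evalTrunc_X₁_X₀, neg_zero, zero_sub, neg_zero,
    zero_add, add_zero, ← map_add, eq_comm, ← map_zero (Ideal.Quotient.mk (truncIdeal Bool k N)),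
    mk_eq_mk_iff] at h
  ext w
  rw [add_apply, zero_apply]
  by_cases hw : w.length ≤ N
  · have := h w hw
    rw [add_apply, zero_apply] at this
    rw [add_comm]; exact this
  · rw [not_le] at hw
    rw [swapXY_apply, hsupp w hw, hsupp (w.map not) (by simpa using hw), add_zero]

end Linearized

end NCSeries

end Literature.NumberTheory.Transcendental
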